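import Mathlib.Analysis.Normed.Module.HahnBanach
import Literature.Analysis.FunctionSpaces.TorusMollifierAllOrders
import HarnessLib

/-!
# Mollification on the flat torus does not increase the sup norm of any derivative;
# the sup-norm mollification error; supports of mollifications

Analysis/FunctionSpaces support file (everything proved; no definitions, no named facts).
Three standard facts about the torus mollifier `k_ε ⋆ ·` (`Torus.kernel ε`, a nonnegative
unit-mass smooth bump of radius `ε ≤ 1/4` on `T^d = (ℝ/ℤ)^d`) acting on smooth VECTOR-valued
functions `k : T^d → F`, in the Fréchet-derivative currency `‖Dⁿ(k ∘ proj)‖` of the tree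
(`Torus.lift`, Mathlib's `iteratedFDeriv`):

* `Torus.norm_iteratedFDeriv_lift_kernel_convolution_le_of_forall_le'` — **mollification does
  not increase `‖Dⁿ·‖_∞`**: if `‖Dⁿ(k∘proj)‖ ≤ A` everywhere then `‖Dⁿ((k_ε ⋆ k)∘proj)‖ ≤ A`
  everywhere (Evans, *PDE*, App. C.4 Thm. 7 (i): `Dᵅ(η_ε ⋆ f) = η_ε ⋆ Dᵅf`, with `∫η_ε = 1`,
  `η_ε ≥ 0`). The derivatives are moved onto `k` for real-valued `k` by commuting the convolution
  (`Torus.norm_iteratedFDeriv_lift_convolution_le` with the roles of the factors exchanged), and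
  the vector-valued case is reduced to the real one by duality: `φ ∘ (k_ε ⋆ k) = k_ε ⋆ (φ ∘ k)` for
  `φ ∈ F*`, `Dⁿ(φ ∘ f) = φ ∘ Dⁿf`, and the norm of a multilinear map is attained on functionals of
  norm `≤ 1` (Hahn–Banach, `exists_dual_vector''`; `ContinuousMultilinearMap.opNorm_le_of_forall_dual`);
* `Torus.norm_kernel_convolution_sub_self_le_of_fderiv_le` — **the mollification error in sup
  norm**: `‖(k_ε ⋆ k)(x) - k(x)‖ ≤ Lε` when `‖D(k∘proj)‖ ≤ L` (Evans, App. C.4 Thm. 7 (ii)–(iii) /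
  the estimate `‖f - f ⋆ ψ_ℓ‖₀ ≲ ℓ‖f‖₁` of Buckmaster–De Lellis–Székelyhidi–Vicol, Prop. 2.2);
* `Torus.kernel_convolution_eq_zero_of_forall_dist_lt` — **supports**: `(k_ε ⋆ k)(x) = 0` when `k`
  vanishes on the `ε`-ball around `x`; hence `supp(k_ε ⋆ k)` lies in the `ε`-neighbourhood of
  `supp k` (`Torus.kernel_convolution_eq_zero_of_infDist_le`).

These are the forms consumed by multiscale constructions whose building blocks are mollified
(M. P. Coiculescu, S. Palasek, Invent. Math. 244 (2025), Def. 3.5: `ψ_k⁰ = φ_k ∗ ∑_j a_{j,k}Ψ⁰_{j,k}`,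
"mollification at a sequence of length scales shrinking to zero plays a Nash–Moser-type role";
Prop. 3.7 and Prop. 4.1 use `‖φ_k ∗ f‖_{Cⁿ} ≤ ‖f‖_{Cⁿ}`, `‖φ_ℓ ∗ f - f‖_∞ ≲ ℓ‖∇f‖_∞` and the support
of `ψ_k⁰`).

## Mathlib / tree search

Tree: `Torus.kernel`, `Torus.isSmooth_kernel`, `Torus.kernel_nonneg`, `Torus.integral_kernel`,
`Torus.kernel_eq_zero_of_le`, `Torus.support_profile_subset`, `Torus.norm_le_norm_reprc`
(`TorusMollifier`), `Torus.norm_iteratedFDeriv_lift_convolution_le`, `Torus.itDeriv`,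
`Torus.iteratedFDeriv_lift_apply` (`TorusMollifierAllOrders`), `Torus.convolution_comm_real`,
`Torus.lift_convolution` (`TorusConvolution`), `Torus.IsSmooth.comp_clm` (`FlatTorus`).
Mathlib: `exists_dual_vector''`, `ContinuousLinearMap.iteratedFDeriv_comp_left`,
`ContinuousLinearMap.norm_compContinuousMultilinearMap_le`, `ContinuousLinearMap.integral_comp_comm`,
`convolution_lsmul`. `lean search` found the real-valued,
derivative-on-the-kernel and first-order versions only (`norm_kernel_convolution_le`,
`abs_convolution_kernel_sub_self_le` for Hölder `f`).

## References

* L. C. Evans, *Partial Differential Equations*, 2nd ed., AMS 2010, App. C.4 Thm. 7. [Evans2010]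
* T. Buckmaster, C. De Lellis, L. Székelyhidi Jr., V. Vicol, CPAM 72 (2019), Prop. 2.2 (mollification
  estimates). [BuckmasterEtAl2018]
* M. P. Coiculescu, S. Palasek, Invent. Math. 244 (2025) 165–219, arXiv:2503.14699, Def. 3.5, Prop. 3.7,
  Prop. 4.1. [CoiculescuPalasek2025]
-/

noncomputable section

open Set Metric Function MeasureTheory Filter ContinuousLinearMap
open scoped BigOperators ContDiff Convolution Topology

/-! ## Norms of multilinear maps through functionals -/

/-- **The norm of a continuous multilinear map is detected by functionals of norm `≤ 1`**
(Hahn–Banach): if `‖φ ∘ M‖ ≤ A` for every `φ ∈ F*` with `‖φ‖ ≤ 1`, then `‖M‖ ≤ A`. [folklore] -/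
theorem ContinuousMultilinearMap.opNorm_le_of_forall_dual {ι : Type*} [Fintype ι]
    {E : ι → Type*} [∀ i, NormedAddCommGroup (E i)] [∀ i, NormedSpace ℝ (E i)]
    {F : Type*} [NormedAddCommGroup F] [NormedSpace ℝ F]
    (M : ContinuousMultilinearMap ℝ E F) {A : ℝ} (hA : 0 ≤ A)
    (h : ∀ φ : F →L[ℝ] ℝ, ‖φ‖ ≤ 1 → ‖φ.compContinuousMultilinearMap M‖ ≤ A) : ‖M‖ ≤ A := by
  refine M.opNorm_le_bound hA fun v => ?_
  obtain ⟨φ, hφ, hφv⟩ := exists_dual_vector'' ℝ (M v)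
  have h1 : ‖M v‖ = φ (M v) := by exact_mod_cast hφv.symm
  have h2 := (φ.compContinuousMultilinearMap M).le_opNorm v
  rw [ContinuousLinearMap.compContinuousMultilinearMap_coe, comp_apply, Real.norm_eq_abs] at h2
  rw [h1]
  exact (le_abs_self _).trans
    (h2.trans (mul_le_mul_of_nonneg_right (h φ hφ) (Finset.prod_nonneg fun i _ => norm_nonneg _)))

namespace Literature.Analysis.FunctionSpaces

namespace Torus

variable {d : Type*} [Fintype d] [DecidableEq d]
variable {F : Type*} [NormedAddCommGroup F] [NormedSpace ℝ F] [CompleteSpace F]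
variable {ε : ℝ}

/-! ## Functionals commute with mollification -/

omit [DecidableEq d] in
/-- `φ ∘ (θ ⋆ k) = θ ⋆ (φ ∘ k)` for a continuous linear functional `φ` (linearity of the Bochner
integral), `θ` integrable and `k` continuous. [folklore] -/
theorem clm_comp_convolution (φ : F →L[ℝ] ℝ) {θ : UnitAddTorus d → ℝ} (hθ : Integrable θ volume)
    {k : UnitAddTorus d → F} (hk : Continuous k) :
    (φ ∘ (θ ⋆ k)) = θ ⋆ (φ ∘ k) := by
  funext x
  simp only [comp_apply, convolution_lsmul]
  rw [← φ.integral_comp_comm (integrable_smul_comp_sub hθ hk x)]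
  refine integral_congr_ae (Eventually.of_forall fun t => ?_)
  simp only [map_smul, smul_eq_mul]

omit [Fintype d] [DecidableEq d] [CompleteSpace F] in
/-- `lift (φ ∘ k) = φ ∘ lift k`. [folklore] -/
theorem lift_clm_comp (φ : F →L[ℝ] ℝ) (k : UnitAddTorus d → F) : lift (φ ∘ k) = φ ∘ lift k := rfl

omit [DecidableEq d] [CompleteSpace F] in
/-- Deprecated duplicate of `IsSmooth.comp_clm` (`FlatTorus`, any target space); use that. [folklore] -/
@[deprecated IsSmooth.comp_clm (since := "2026-08-16")]
theorem IsSmooth.clm_comp (φ : F →L[ℝ] ℝ) {k : UnitAddTorus d → F} (hk : IsSmooth k) :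
    IsSmooth (φ ∘ k) := IsSmooth.comp_clm φ hk

omit [DecidableEq d] [CompleteSpace F] in
/-- `‖Dⁿ((φ ∘ k)∘proj)(y)‖ ≤ ‖φ‖ ‖Dⁿ(k∘proj)(y)‖`. [folklore] -/
theorem norm_iteratedFDeriv_lift_clm_comp_le (φ : F →L[ℝ] ℝ) {k : UnitAddTorus d → F}
    (hk : IsSmooth k) (n : ℕ) (y : EuclideanSpace ℝ d) :
    ‖iteratedFDeriv ℝ n (lift (φ ∘ k)) y‖ ≤ ‖φ‖ * ‖iteratedFDeriv ℝ n (lift k) y‖ := by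
  rw [lift_clm_comp]
  exact φ.norm_iteratedFDeriv_comp_left hk.contDiffAt (by exact_mod_cast le_top)

/-! ## Mollification does not increase the sup norm of any derivative -/

omit [DecidableEq d] in
/-- **Real-valued case**: if `‖Dⁿ(g∘proj)‖ ≤ A` everywhere then `‖Dⁿ((k_ε ⋆ g)∘proj)(x)‖ ≤ A`
(`k_ε ⋆ g = g ⋆ k_ε`, all derivatives on `g`, `∫ k_ε = 1`, `k_ε ≥ 0`). [cite: Evans2010, App. C.4 Thm. 7 (i)] -/
theorem norm_iteratedFDeriv_lift_kernel_convolution_real_le (hε : 0 < ε) (hε' : ε ≤ 1 / 4)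
    {g : UnitAddTorus d → ℝ} (hg : IsSmooth g) {n : ℕ} {A : ℝ}
    (hA : ∀ y, ‖iteratedFDeriv ℝ n (lift g) y‖ ≤ A) (x : EuclideanSpace ℝ d) :
    ‖iteratedFDeriv ℝ n (lift (kernel ε ⋆ g)) x‖ ≤ A := by
  have hκ := isSmooth_kernel (d := d) hε hε'
  rw [convolution_comm_real (kernel ε) g]
  refine (norm_iteratedFDeriv_lift_convolution_le hκ n hg x).trans ?_
  have hpt : ∀ y : UnitAddTorus d, ‖itDeriv n g (proj x - y)‖ * ‖kernel ε y‖ ≤ A * kernel ε y := by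
    intro y
    rw [Real.norm_eq_abs, abs_of_nonneg (kernel_nonneg hε.le y)]
    refine mul_le_mul_of_nonneg_right ?_ (kernel_nonneg hε.le y)
    obtain ⟨z, hz⟩ := proj_surjective (proj x - y)
    rw [← hz, ← iteratedFDeriv_lift_apply]
    exact hA z
  calc ∫ y, ‖itDeriv n g (proj x - y)‖ * ‖kernel ε y‖
      ≤ ∫ y, A * kernel ε y :=
        integral_mono ((((hg.continuous_itDeriv n).comp (continuous_const.sub continuous_id)).norm.mul
          (continuous_kernel hε hε').norm).integrable_unitAddTorus)
          ((continuous_kernel hε hε').integrable_unitAddTorus.const_mul A) hpt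
    _ = A := by rw [integral_const_mul, integral_kernel hε hε', mul_one]

omit [DecidableEq d] in
/-- **Mollification does not increase `‖Dⁿ·‖_∞` (vector-valued).** For smooth `k : T^d → F` with
`‖Dⁿ(k∘proj)‖ ≤ A` everywhere and `0 < ε ≤ 1/4`: `‖Dⁿ((k_ε ⋆ k)∘proj)(x)‖ ≤ A` for every `x`
(the real case through every functional of norm `≤ 1`, then Hahn–Banach). This is
`‖φ_ℓ ∗ f‖_{Cⁿ} ≤ ‖f‖_{Cⁿ}`, the "`L^∞` boundedness of the mollifier" used throughout the proofs of
Lemma 3.6, Prop. 3.7 and Prop. 4.1 of Coiculescu–Palasek. [cite: Evans2010, App. C.4 Thm. 7 (i)] -/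
theorem norm_iteratedFDeriv_lift_kernel_convolution_le_of_forall_le' (hε : 0 < ε) (hε' : ε ≤ 1 / 4)
    {k : UnitAddTorus d → F} (hk : IsSmooth k) {n : ℕ} {A : ℝ}
    (hA : ∀ y, ‖iteratedFDeriv ℝ n (lift k) y‖ ≤ A) (x : EuclideanSpace ℝ d) :
    ‖iteratedFDeriv ℝ n (lift (kernel ε ⋆ k)) x‖ ≤ A := by
  have hA0 : 0 ≤ A := (norm_nonneg _).trans (hA x)
  have hκi := (isSmooth_kernel (d := d) hε hε').integrable
  have hsm : IsSmooth (kernel ε ⋆ k) := isSmooth_convolution hκi hk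
  refine ContinuousMultilinearMap.opNorm_le_of_forall_dual _ hA0 fun φ hφ => ?_
  rw [← φ.iteratedFDeriv_comp_left hsm.contDiffAt (i := n) (by exact_mod_cast le_top),
    ← lift_clm_comp, clm_comp_convolution φ hκi hk.continuous]
  refine norm_iteratedFDeriv_lift_kernel_convolution_real_le hε hε' (hk.comp_clm φ) (fun y => ?_) x
  calc ‖iteratedFDeriv ℝ n (lift (φ ∘ k)) y‖ ≤ ‖φ‖ * ‖iteratedFDeriv ℝ n (lift k) y‖ :=
        norm_iteratedFDeriv_lift_clm_comp_le φ hk n y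
    _ ≤ 1 * A := by gcongr; exact hA y
    _ = A := one_mul A

/-! ## The mollification error in sup norm -/

omit [DecidableEq d] [CompleteSpace F] in
/-- The kernel is supported where the centred representative is `ε`-small: `k_ε(t) ≠ 0` forces
`‖reprc t‖ < ε`. [folklore] -/
theorem norm_reprc_lt_of_kernel_ne_zero (hε : 0 < ε) {t : UnitAddTorus d} (ht : kernel ε t ≠ 0) :
    ‖reprc t‖ < ε := by
  have h : reprc t ∈ support (profile (d := d) ε) := by
    rw [mem_support]; exact ht
  exact mem_ball_zero_iff.1 (support_profile_subset hε h)

omit [DecidableEq d] in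
/-- `(k_ε ⋆ k)(x) - k(x) = ∫ k_ε(t) (k(x - t) - k(x)) dt` (unit mass). [folklore] -/
theorem kernel_convolution_sub_self_eq (hε : 0 < ε) (hε' : ε ≤ 1 / 4) {k : UnitAddTorus d → F}
    (hk : Continuous k) (x : UnitAddTorus d) :
    (kernel ε ⋆ k) x - k x = ∫ t, kernel ε t • (k (x - t) - k x) := by
  have hκi := (isSmooth_kernel (d := d) hε hε').integrable
  rw [convolution_lsmul]
  have h1 : ∫ t : UnitAddTorus d, kernel ε t • k x = k x := by
    rw [integral_smul_const, integral_kernel hε hε', one_smul]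
  simp_rw [smul_sub]
  rw [integral_sub (integrable_smul_comp_sub hκi hk x) (hκi.smul_const _), h1]

omit [DecidableEq d] in
/-- **The mollification error in sup norm**: if `‖D(k∘proj)‖ ≤ L` everywhere then
`‖(k_ε ⋆ k)(x) - k(x)‖ ≤ L ε` (`k(x-t) - k(x)` is an increment of the `L`-Lipschitz lift over the
vector `reprc t` of length `< ε` wherever `k_ε(t) ≠ 0`). This is `‖f - f ∗ ψ_ℓ‖₀ ≲ ℓ ‖∇f‖₀`.
[cite: Evans2010, App. C.4 Thm. 7; BuckmasterEtAl2018, Prop. 2.2] -/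
theorem norm_kernel_convolution_sub_self_le_of_fderiv_le (hε : 0 < ε) (hε' : ε ≤ 1 / 4)
    {k : UnitAddTorus d → F} (hk : IsSmooth k) {L : ℝ}
    (hL : ∀ y, ‖_root_.fderiv ℝ (lift k) y‖ ≤ L) (x : UnitAddTorus d) :
    ‖(kernel ε ⋆ k) x - k x‖ ≤ L * ε := by
  have hL0 : 0 ≤ L := (norm_nonneg _).trans (hL 0)
  have hκi := (isSmooth_kernel (d := d) hε hε').integrable
  -- the lift is `L`-Lipschitz
  have hlip : ∀ a b : EuclideanSpace ℝ d, ‖lift k a - lift k b‖ ≤ L * ‖a - b‖ := by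
    intro a b
    have hdiff : Differentiable ℝ (lift k) := ContDiff.differentiable hk (by simp)
    exact Convex.norm_image_sub_le_of_norm_fderiv_le (s := univ) (f := lift k)
      (fun y _ => hdiff.differentiableAt) (fun y _ => hL y) convex_univ (mem_univ b) (mem_univ a)
  -- pointwise bound on the integrand
  have hpt : ∀ t : UnitAddTorus d, ‖kernel ε t • (k (x - t) - k x)‖ ≤ kernel ε t * (L * ε) := by
    intro t
    by_cases ht : kernel ε t = 0
    · simp [ht]
    · have hlt := norm_reprc_lt_of_kernel_ne_zero hε ht
      rw [norm_smul, Real.norm_eq_abs, abs_of_nonneg (kernel_nonneg hε.le t)]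
      refine mul_le_mul_of_nonneg_left ?_ (kernel_nonneg hε.le t)
      obtain ⟨a, rfl⟩ := proj_surjective x
      have hb : proj (a - reprc t) = proj a - t := by
        rw [sub_eq_add_neg, proj_add, proj_neg, proj_reprc, ← sub_eq_add_neg]
      have h := hlip (a - reprc t) a
      rw [lift_apply, lift_apply, hb, sub_sub_cancel_left, norm_neg] at h
      exact h.trans (mul_le_mul_of_nonneg_left hlt.le hL0)
  rw [kernel_convolution_sub_self_eq hε hε' hk.continuous x]
  calc ‖∫ t, kernel ε t • (k (x - t) - k x)‖ ≤ ∫ t, kernel ε t * (L * ε) :=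
        norm_integral_le_of_norm_le (hκi.mul_const _) (Eventually.of_forall hpt)
    _ = L * ε := by rw [integral_mul_const, integral_kernel hε hε', one_mul]

omit [DecidableEq d] in
/-- The mollification error from a bound on `D¹` in the `iteratedFDeriv` currency:
`‖(k_ε ⋆ k)(x) - k(x)‖ ≤ L ε` when `‖D¹(k∘proj)‖ ≤ L`. [cite: Evans2010, App. C.4 Thm. 7] -/
theorem norm_kernel_convolution_sub_self_le_of_iteratedFDeriv_one_le (hε : 0 < ε) (hε' : ε ≤ 1 / 4)
    {k : UnitAddTorus d → F} (hk : IsSmooth k) {L : ℝ}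
    (hL : ∀ y, ‖iteratedFDeriv ℝ 1 (lift k) y‖ ≤ L) (x : UnitAddTorus d) :
    ‖(kernel ε ⋆ k) x - k x‖ ≤ L * ε := by
  refine norm_kernel_convolution_sub_self_le_of_fderiv_le hε hε' hk (fun y => ?_) x
  rw [← norm_iteratedFDeriv_zero (𝕜 := ℝ) (f := _root_.fderiv ℝ (lift k)), norm_iteratedFDeriv_fderiv]
  exact hL y

/-! ## Supports of mollifications -/

omit [DecidableEq d] [CompleteSpace F] in
/-- If `k` vanishes on the `ε`-ball around `x` then `(k_ε ⋆ k)(x) = 0`. [folklore] -/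
theorem kernel_convolution_eq_zero_of_forall_dist_lt (hε : 0 < ε) {k : UnitAddTorus d → F}
    {x : UnitAddTorus d} (hk : ∀ y, dist y x < ε → k y = 0) : (kernel ε ⋆ k) x = 0 := by
  rw [convolution_lsmul]
  have hpt : ∀ t : UnitAddTorus d, kernel ε t • k (x - t) = 0 := by
    intro t
    by_cases ht : ε ≤ ‖t‖
    · rw [kernel_eq_zero_of_le hε ht, zero_smul]
    · rw [hk (x - t) (by rw [dist_eq_norm, sub_sub_cancel_left, norm_neg]; exact not_le.1 ht),
        smul_zero]
  simp_rw [hpt]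
  exact integral_zero _ _

omit [DecidableEq d] [CompleteSpace F] in
/-- **Supports of mollifications**: if `x` is at distance `≥ ε` from the support of `k` then
`(k_ε ⋆ k)(x) = 0`; i.e. `supp (k_ε ⋆ k)` lies in the open `ε`-neighbourhood of `supp k`.
[cite: Evans2010, App. C.4 Thm. 7] -/
theorem kernel_convolution_eq_zero_of_infDist_le (hε : 0 < ε) {k : UnitAddTorus d → F}
    {x : UnitAddTorus d} (hx : x ∉ thickening ε (support k)) : (kernel ε ⋆ k) x = 0 := by
  refine kernel_convolution_eq_zero_of_forall_dist_lt hε fun y hy => ?_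
  by_contra hky
  exact hx (mem_thickening_iff.2 ⟨y, mem_support.2 hky, by rwa [dist_comm]⟩)

omit [DecidableEq d] [CompleteSpace F] in
/-- The support of a mollification lies in the `ε`-neighbourhood of the support.
[cite: Evans2010, App. C.4 Thm. 7] -/
theorem support_kernel_convolution_subset (hε : 0 < ε) (k : UnitAddTorus d → F) :
    support (kernel ε ⋆ k) ⊆ thickening ε (support k) := by
  intro x hx
  by_contra h
  exact hx (kernel_convolution_eq_zero_of_infDist_le hε h)

end Torus

end Literature.Analysis.FunctionSpaces
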